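import Literature.AlgebraicGeometry.Motives.ConjugateVarietyPointEval
import Literature.AlgebraicGeometry.Motives.BaseChangePointsProofs
import HarnessLib

/-!
# Complex points of a conjugate variety, II: the bijection `Y(ℂ) ≃ Y^σ(ℂ)`, the section dictionary, and the homeomorphism for continuous `σ`

Companion of `Motives/ConjugateVarietyPointEval.lean`.  For a field automorphism `σ ∈ Aut ℂ` and
a `ℂ`-scheme `Y`, the conjugate variety `Y^σ = Y ×_{Spec ℂ, Spec σ} Spec ℂ`
(`Motives.conjugateVariety σ Y`) has first projection `π : Y^σ ⟶ Y` (`AlgPoints.conjFst`), an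
isomorphism of ABSTRACT schemes, `σ`-semilinear over the base (Charles–Schnell, *Notes on absolute
Hodge classes*, §11.2.2, (11.2.1)).  That file constructs the complex point
`AlgPoints.ofConjugate σ Y y' = Spec(σ⁻¹) ≫ y' ≫ π` of `Y` under a complex point `y'` of `Y^σ` and
proves that values transform by `σ`.  Here:

* `AlgPoints.toConjugate σ Y P` — the complex point `(Spec σ ≫ P, 𝟙)` of the fibre product
  `Y^σ` over a complex point `P` of `Y`; `ofConjugate_toConjugate`, `toConjugate_ofConjugate` — it is
  the two-sided inverse of `ofConjugate`, packaged as `AlgPoints.conjugateEquiv σ Y : Y(ℂ) ≃ Y^σ(ℂ)`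
  (Charles–Schnell's `σ : X(ℂ) → X^σ(ℂ)`, (11.2.1));
* `AlgPoints.evalOrZero_conjFst_toConjugate` — **values transform by `σ`**:
  `(π^* a)(toConjugate P) = σ (a(P))`;
* the SECTION DICTIONARY along the scheme isomorphism `π` (`AlgPoints.isIso_conjFst`): every open
  `U'` of `Y^σ` is `π⁻¹ U` for the open `U := (inv π)⁻¹ U'` of `Y` (`conjFst_preimage_invPreimage`),
  affine when `U'` is (`isAffineOpen_invPreimage`), and every section `f'` of `Y^σ` over `U'`
  evaluates as the conjugated section `π^* ((inv π)^* f')`: `evalOrZero_eq_evalOrZero_conjFst_app`;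
  hence `evalOrZero_toConjugate` — `f'(toConjugate P) = σ (((inv π)^* f')(P))` for EVERY regular
  function `f'` on `Y^σ`;
* for a CONTINUOUS `σ` (complex conjugation, or the identity — `Complex.ringHom_eq_id_or_conj_of_continuous`):
  `AlgPoints.continuous_toConjugate`, `AlgPoints.continuous_ofConjugate` and the homeomorphism
  `AlgPoints.conjugateHomeomorph σ hσ Y : Y(ℂ) ≃ₜ Y^σ(ℂ)` for the strong (analytic) topologies
  (Serre, GAGA §2: for `σ` = complex conjugation this is the anti-holomorphic identification
  `Y(ℂ) → Ȳ(ℂ)`; for a discontinuous `σ` no such homeomorphism exists in general — Serre 1964,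
  catalogued in `Literature/Barriers/HodgeConjecture/ConjugateVarieties.lean`).

Everything is proved; no definitions of `Prop`s, no named facts.

## References

* F. Charles, C. Schnell, *Notes on absolute Hodge classes* (2014), §11.2.2, (11.2.1). [CharlesSchnell2014Notes]
* J.-P. Serre, *Géométrie algébrique et géométrie analytique*, Ann. Inst. Fourier 6 (1956), §2. [SerreGAGA1956]
* R. Hartshorne, *Algebraic Geometry*, II Ex. 2.7, II.3 (base extension).
-/

noncomputable section

open CategoryTheory CategoryTheory.Limits AlgebraicGeometry Topology

namespace Literature.AlgebraicGeometry.Motives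

namespace AlgPoints

variable (σ : ℂ ≃+* ℂ) (Y : SchemeOver ℂ)

/-! ### The complex point of `Y^σ` over a complex point of `Y` -/

/-- The structure map of a complex point of a `ℂ`-scheme is the identity of `Spec ℂ`. [folklore] -/
private theorem toSpecHom_comp_hom (P : ComplexPoints Y) : P.toSpecHom ≫ Y.hom = 𝟙 _ := by
  have h : P.toSpecHom ≫ Y.hom = Spec.map (CommRingCat.ofHom (algebraMap ℂ ℂ)) := Over.w P
  rw [h, Algebra.algebraMap_self, CommRingCat.ofHom_id, Spec.map_id]

/-- `Spec(σ) ≫ Spec(σ⁻¹) = 𝟙` for a field automorphism `σ` (functoriality of `Spec`). [folklore] -/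
private theorem specMap_comp_specMap_symm :
    Spec.map (CommRingCat.ofHom σ.toRingHom) ≫ Spec.map (CommRingCat.ofHom σ.symm.toRingHom) =
      𝟙 _ := by
  simpa only [RingEquiv.symm_symm] using specMap_symm_comp_specMap σ.symm

/-- **The complex point of `Y^σ` over a complex point `P` of `Y`**: the morphism
`(Spec ℂ —Spec(σ)→ Spec ℂ —P→ Y, 𝟙) : Spec ℂ ⟶ Y ×_{Spec ℂ, Spec σ} Spec ℂ = Y^σ` into the fibre
product (the square commutes because the structure map of `P` is the identity).  On closed points
this is Charles–Schnell's bijection `σ : Y(ℂ) → Y^σ(ℂ)`; it is inverse to `AlgPoints.ofConjugate`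
(`ofConjugate_toConjugate`, `toConjugate_ofConjugate`). [cite: CharlesSchnell2014Notes, §11.2.2 (11.2.1)] -/
def toConjugate (P : ComplexPoints Y) : ComplexPoints (conjugateVariety σ Y) :=
  AlgPoints.mk
    (pullback.lift (Spec.map (CommRingCat.ofHom σ.toRingHom) ≫ P.toSpecHom) (𝟙 _) (by
      rw [Category.assoc, toSpecHom_comp_hom, Category.comp_id, Category.id_comp]))
    (by
      change pullback.lift _ _ _ ≫ pullback.snd _ _ = _
      rw [pullback.lift_snd, Algebra.algebraMap_self, CommRingCat.ofHom_id, Spec.map_id])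

variable {σ Y}

/-- `toConjugate P` lies over `Spec(σ) ≫ P` along the first projection `π : Y^σ ⟶ Y`. [cite: CharlesSchnell2014Notes, §11.2.2 (11.2.1)] -/
@[simp, reassoc]
theorem toSpecHom_toConjugate_comp_conjFst (P : ComplexPoints Y) :
    (toConjugate σ Y P).toSpecHom ≫ conjFst σ Y =
      Spec.map (CommRingCat.ofHom σ.toRingHom) ≫ P.toSpecHom :=
  pullback.lift_fst _ _ _

/-- `toConjugate P` is a point over `Spec ℂ`: its second projection is the identity. [cite: CharlesSchnell2014Notes, §11.2.2 (11.2.1)] -/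
@[simp, reassoc]
theorem toSpecHom_toConjugate_comp_snd (P : ComplexPoints Y) :
    (toConjugate σ Y P).toSpecHom ≫
        pullback.snd Y.hom (Spec.map (CommRingCat.ofHom σ.toRingHom)) = 𝟙 _ :=
  pullback.lift_snd _ _ _

/-- `ofConjugate ∘ toConjugate = id`: `Spec(σ⁻¹) ≫ Spec(σ) ≫ P = P`. [cite: CharlesSchnell2014Notes, §11.2.2 (11.2.1)] -/
@[simp]
theorem ofConjugate_toConjugate (P : ComplexPoints Y) :
    ofConjugate σ Y (toConjugate σ Y P) = P := by
  ext : 1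
  change (ofConjugate σ Y (toConjugate σ Y P)).toSpecHom = P.toSpecHom
  rw [toSpecHom_ofConjugate, toSpecHom_toConjugate_comp_conjFst, ← Category.assoc,
    specMap_symm_comp_specMap, Category.id_comp]

/-- Two complex points of `Y^σ` with the same composite to `Y` along `π` are equal (both are
points over `Spec ℂ`, so their second projections agree as well). [cite: CharlesSchnell2014Notes, §11.2.2 (11.2.1)] -/
theorem ext_of_comp_conjFst {y₁ y₂ : ComplexPoints (conjugateVariety σ Y)}
    (h : y₁.toSpecHom ≫ conjFst σ Y = y₂.toSpecHom ≫ conjFst σ Y) : y₁ = y₂ := by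
  ext : 1
  apply pullback.hom_ext
  · exact h
  · exact ((toSpecHom_comp_hom (conjugateVariety σ Y) y₁).trans
      (toSpecHom_comp_hom (conjugateVariety σ Y) y₂).symm)

/-- `toConjugate ∘ ofConjugate = id` (both projections of the fibre product agree). [cite: CharlesSchnell2014Notes, §11.2.2 (11.2.1)] -/
@[simp]
theorem toConjugate_ofConjugate (y' : ComplexPoints (conjugateVariety σ Y)) :
    toConjugate σ Y (ofConjugate σ Y y') = y' := by
  apply ext_of_comp_conjFst
  rw [toSpecHom_toConjugate_comp_conjFst, toSpecHom_ofConjugate, ← Category.assoc,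
    ← Category.assoc, specMap_comp_specMap_symm, Category.id_comp]

variable (σ Y) in
/-- **`Y(ℂ) ≃ Y^σ(ℂ)`**, `P ↦ toConjugate P`, with inverse `ofConjugate` (Charles–Schnell's
`σ : X(ℂ) → X^σ(ℂ)`, as a bijection of sets). [cite: CharlesSchnell2014Notes, §11.2.2 (11.2.1)] -/
def conjugateEquiv : ComplexPoints Y ≃ ComplexPoints (conjugateVariety σ Y) where
  toFun := toConjugate σ Y
  invFun := ofConjugate σ Y
  left_inv := ofConjugate_toConjugate
  right_inv := toConjugate_ofConjugate

/-- `conjugateEquiv` is `toConjugate`. [cite: CharlesSchnell2014Notes, §11.2.2 (11.2.1)] -/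
@[simp] theorem conjugateEquiv_apply (P : ComplexPoints Y) : conjugateEquiv σ Y P = toConjugate σ Y P := rfl

/-- The inverse of `conjugateEquiv` is `ofConjugate`. [cite: CharlesSchnell2014Notes, §11.2.2 (11.2.1)] -/
@[simp] theorem conjugateEquiv_symm_apply (y' : ComplexPoints (conjugateVariety σ Y)) :
    (conjugateEquiv σ Y).symm y' = ofConjugate σ Y y' := rfl

/-- `toConjugate` is a bijection. [cite: CharlesSchnell2014Notes, §11.2.2 (11.2.1)] -/
theorem bijective_toConjugate : Function.Bijective (toConjugate σ Y) :=
  (conjugateEquiv σ Y).bijective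

/-- `ofConjugate` is a bijection. [cite: CharlesSchnell2014Notes, §11.2.2 (11.2.1)] -/
theorem bijective_ofConjugate : Function.Bijective (ofConjugate σ Y) :=
  (conjugateEquiv σ Y).symm.bijective

/-! ### Underlying points and values -/

/-- The point of `Y` under `toConjugate P` is the point of `P`: `π (toConjugate P).pt = P.pt`. [cite: CharlesSchnell2014Notes, §11.2.2 (11.2.1)] -/
theorem conjFst_base_pt_toConjugate (P : ComplexPoints Y) :
    (conjFst σ Y).base (toConjugate σ Y P).pt = P.pt := by
  rw [← pt_ofConjugate, ofConjugate_toConjugate]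

/-- `toConjugate P ∈ π⁻¹ V ↔ P ∈ V`. [cite: CharlesSchnell2014Notes, §11.2.2 (11.2.1)] -/
theorem pt_toConjugate_mem_iff (P : ComplexPoints Y) (V : Y.left.Opens) :
    (toConjugate σ Y P).pt ∈ conjFst σ Y ⁻¹ᵁ V ↔ P.pt ∈ V := by
  rw [← pt_ofConjugate_mem_iff, ofConjugate_toConjugate]

/-- **Values of conjugated functions transform by `σ`**, read at `toConjugate P`:
`(π^* a)(toConjugate P) = σ (a(P))` for `a ∈ Γ(Y, V)` (total version, both sides vanish off `V`).
[cite: CharlesSchnell2014Notes, §11.2.2 (11.2.1)] -/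
theorem evalOrZero_conjFst_toConjugate (P : ComplexPoints Y) (V : Y.left.Opens) (a : Γ(Y.left, V)) :
    evalOrZero (conjFst σ Y ⁻¹ᵁ V) ((conjFst σ Y).app V a) (toConjugate σ Y P) =
      σ (evalOrZero V a P) := by
  rw [evalOrZero_app_conjFst, ofConjugate_toConjugate]

/-! ### The section dictionary along the isomorphism `π : Y^σ ⟶ Y` -/

/-- `Spec(σ)` is an isomorphism for a ring automorphism `σ`. [folklore] -/
instance isIso_specMap_ofHom_ringEquiv : IsIso (Spec.map (CommRingCat.ofHom σ.toRingHom)) :=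
  ⟨⟨Spec.map (CommRingCat.ofHom σ.symm.toRingHom), specMap_comp_specMap_symm σ,
    specMap_symm_comp_specMap σ⟩⟩

variable (σ Y) in
/-- **The projection `π : Y^σ ⟶ Y` is an isomorphism of schemes** (base change along an
automorphism of the base; it is NOT a morphism of `ℂ`-schemes). [cite: CharlesSchnell2014Notes, §11.2.2 (11.2.1)] -/
instance isIso_conjFst : IsIso (conjFst σ Y) := by
  change IsIso (pullback.fst Y.hom (Spec.map (CommRingCat.ofHom σ.toRingHom)))
  infer_instance

variable (σ Y) in
/-- The open of `Y` corresponding to an open `U'` of `Y^σ` under the isomorphism `π`: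
`(inv π)⁻¹ U'`. (An abbreviation, for readability of the dictionary below.) [folklore] -/
abbrev invPreimage (U' : (conjugateVariety σ Y).left.Opens) : Y.left.Opens :=
  (inv (conjFst σ Y)) ⁻¹ᵁ U'

/-- `π⁻¹ ((inv π)⁻¹ U') = U'`. [cite: CharlesSchnell2014Notes, §11.2.2 (11.2.1)] -/
theorem conjFst_preimage_invPreimage (U' : (conjugateVariety σ Y).left.Opens) :
    conjFst σ Y ⁻¹ᵁ invPreimage σ Y U' = U' := by
  change (conjFst σ Y ≫ inv (conjFst σ Y)) ⁻¹ᵁ U' = U'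
  rw [IsIso.hom_inv_id]
  rfl

/-- `(inv π)⁻¹ (π⁻¹ U) = U`. [cite: CharlesSchnell2014Notes, §11.2.2 (11.2.1)] -/
theorem invPreimage_conjFst_preimage (U : Y.left.Opens) :
    invPreimage σ Y (conjFst σ Y ⁻¹ᵁ U) = U := by
  change (inv (conjFst σ Y) ≫ conjFst σ Y) ⁻¹ᵁ U = U
  rw [IsIso.inv_hom_id]
  rfl

/-- `(inv π)⁻¹ U'` is affine when `U'` is (preimage of an affine open under an isomorphism).
[cite: CharlesSchnell2014Notes, §11.2.2 (11.2.1)] -/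
theorem isAffineOpen_invPreimage {U' : (conjugateVariety σ Y).left.Opens} (hU' : IsAffineOpen U') :
    IsAffineOpen (invPreimage σ Y U') :=
  hU'.preimage_of_isIso (inv (conjFst σ Y))

/-- `y' ∈ U' ↔ (ofConjugate y') ∈ (inv π)⁻¹ U'`. [cite: CharlesSchnell2014Notes, §11.2.2 (11.2.1)] -/
theorem pt_ofConjugate_mem_invPreimage_iff (y' : ComplexPoints (conjugateVariety σ Y))
    (U' : (conjugateVariety σ Y).left.Opens) :
    (ofConjugate σ Y y').pt ∈ invPreimage σ Y U' ↔ y'.pt ∈ U' := by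
  rw [pt_ofConjugate_mem_iff, conjFst_preimage_invPreimage]

/-- `toConjugate P ∈ U' ↔ P ∈ (inv π)⁻¹ U'`. [cite: CharlesSchnell2014Notes, §11.2.2 (11.2.1)] -/
theorem pt_toConjugate_mem_iff' (P : ComplexPoints Y) (U' : (conjugateVariety σ Y).left.Opens) :
    (toConjugate σ Y P).pt ∈ U' ↔ P.pt ∈ invPreimage σ Y U' := by
  have h := pt_toConjugate_mem_iff (σ := σ) P (invPreimage σ Y U')
  rwa [conjFst_preimage_invPreimage] at h

/-- Total version along an EQUALITY of opens (`eqToHom`): `evalOrZero` is unchanged. [folklore] -/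
private theorem evalOrZero_map_eqToHom {k : Type} [Field k] {X : SchemeOver k} {L : Type} [Field L] [Algebra k L]
    (P : AlgPoints X L) {U U' : X.left.Opens} (e : U = U') (f : Γ(X.left, U')) :
    evalOrZero U (X.left.presheaf.map (eqToHom e).op f) P = evalOrZero U' f P := by
  subst e
  simp

/-- Pushing a section of `Y^σ` over `U'` to `Y` along `inv π` and pulling it back along `π`
returns the section, restricted along `π⁻¹ ((inv π)⁻¹ U') = U'`. [cite: CharlesSchnell2014Notes, §11.2.2 (11.2.1)] -/
theorem conjFst_app_inv_app (U' : (conjugateVariety σ Y).left.Opens)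
    (f' : Γ((conjugateVariety σ Y).left, U')) :
    (conjFst σ Y).app (invPreimage σ Y U') ((inv (conjFst σ Y)).app U' f') =
      (conjugateVariety σ Y).left.presheaf.map
        (eqToHom (conjFst_preimage_invPreimage U')).op f' := by
  have h := Scheme.Hom.congr_app (IsIso.hom_inv_id (conjFst σ Y)) U'
  rw [Scheme.Hom.comp_app, Scheme.Hom.id_app] at h
  erw [Category.id_comp] at h
  have h' := ConcreteCategory.congr_hom h f'
  rw [CategoryTheory.comp_apply] at h'
  exact h'

/-- **The section dictionary.**  A section `f'` of `Y^σ` over `U'` is the conjugated section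
`π^* ((inv π)^* f')` over `π⁻¹ ((inv π)⁻¹ U') = U'`; in particular both have the same values at
every complex point of `Y^σ`. [cite: CharlesSchnell2014Notes, §11.2.2 (11.2.1)] -/
theorem evalOrZero_eq_evalOrZero_conjFst_app (U' : (conjugateVariety σ Y).left.Opens)
    (f' : Γ((conjugateVariety σ Y).left, U')) (y' : ComplexPoints (conjugateVariety σ Y)) :
    evalOrZero U' f' y' =
      evalOrZero (conjFst σ Y ⁻¹ᵁ invPreimage σ Y U')
        ((conjFst σ Y).app (invPreimage σ Y U') ((inv (conjFst σ Y)).app U' f')) y' := by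
  rw [conjFst_app_inv_app, evalOrZero_map_eqToHom]

/-- **Every regular function on `Y^σ` takes at `toConjugate P` the value `σ` of a regular function on
`Y` at `P`**: `f'(toConjugate P) = σ (((inv π)^* f')(P))`. [cite: CharlesSchnell2014Notes, §11.2.2 (11.2.1)] -/
theorem evalOrZero_toConjugate (U' : (conjugateVariety σ Y).left.Opens)
    (f' : Γ((conjugateVariety σ Y).left, U')) (P : ComplexPoints Y) :
    evalOrZero U' f' (toConjugate σ Y P) =
      σ (evalOrZero (invPreimage σ Y U') ((inv (conjFst σ Y)).app U' f') P) := by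
  rw [evalOrZero_eq_evalOrZero_conjFst_app, evalOrZero_conjFst_toConjugate]

/-- The same read at `ofConjugate y'`: `f'(y') = σ (((inv π)^* f')(ofConjugate y'))`. [cite: CharlesSchnell2014Notes, §11.2.2 (11.2.1)] -/
theorem evalOrZero_eq_map_evalOrZero_ofConjugate (U' : (conjugateVariety σ Y).left.Opens)
    (f' : Γ((conjugateVariety σ Y).left, U')) (y' : ComplexPoints (conjugateVariety σ Y)) :
    evalOrZero U' f' y' =
      σ (evalOrZero (invPreimage σ Y U') ((inv (conjFst σ Y)).app U' f') (ofConjugate σ Y y')) := by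
  rw [← evalOrZero_toConjugate, toConjugate_ofConjugate]

/-! ### Continuity for a continuous `σ` -/

/-- The preimage under `toConjugate` of a sub-basic set of `Y^σ(ℂ)` is a sub-basic set of `Y(ℂ)`
(for the corresponding open and function of `Y`, and `σ⁻¹(V)`). [folklore] -/
private theorem preimage_toConjugate_basicSet (U' : (conjugateVariety σ Y).left.Opens)
    (f' : Γ((conjugateVariety σ Y).left, U')) (V : Set ℂ) :
    toConjugate σ Y ⁻¹' basicSet U' f' V =
      basicSet (invPreimage σ Y U') ((inv (conjFst σ Y)).app U' f') (σ ⁻¹' V) := by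
  ext P
  simp only [Set.mem_preimage, basicSet_eq_setOf, Set.mem_setOf_eq, pt_toConjugate_mem_iff',
    evalOrZero_toConjugate]

/-- The preimage under `ofConjugate` of a sub-basic set of `Y(ℂ)` is a sub-basic set of `Y^σ(ℂ)`
(for the pulled-back open and function, and `σ(V)`). [folklore] -/
private theorem preimage_ofConjugate_basicSet (U : Y.left.Opens) (f : Γ(Y.left, U)) (V : Set ℂ) :
    ofConjugate σ Y ⁻¹' basicSet U f V =
      basicSet (conjFst σ Y ⁻¹ᵁ U) ((conjFst σ Y).app U f) (σ.symm ⁻¹' V) := by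
  ext y'
  simp only [Set.mem_preimage, basicSet_eq_setOf, Set.mem_setOf_eq, pt_ofConjugate_mem_iff,
    evalOrZero_app_conjFst, RingEquiv.symm_apply_apply]

/-- **`toConjugate` is continuous for a continuous `σ`.** [cite: SerreGAGA1956, §2] -/
theorem continuous_toConjugate (hσ : Continuous σ) : Continuous (toConjugate σ Y) := by
  refine continuous_generateFrom_iff.mpr ?_
  rintro _ ⟨U', f', V, hV, rfl⟩
  rw [preimage_toConjugate_basicSet]
  exact isOpen_basicSet _ _ (hV.preimage hσ)

/-- **`ofConjugate` is continuous when `σ⁻¹` is continuous.** [cite: SerreGAGA1956, §2] -/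
theorem continuous_ofConjugate (hσ' : Continuous σ.symm) : Continuous (ofConjugate σ Y) := by
  refine continuous_generateFrom_iff.mpr ?_
  rintro _ ⟨U, f, V, hV, rfl⟩
  rw [preimage_ofConjugate_basicSet]
  exact isOpen_basicSet _ _ (hV.preimage hσ')

/-- A continuous automorphism of `ℂ` has a continuous inverse (it is the identity or complex
conjugation, `Complex.ringHom_eq_id_or_conj_of_continuous`, both involutions). [folklore] -/
private theorem continuous_symm_of_continuous (hσ : Continuous σ) : Continuous σ.symm := by
  have key : ∀ z, σ.symm z = σ z := by
    intro z
    apply σ.injective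
    rw [σ.apply_symm_apply]
    rcases Complex.ringHom_eq_id_or_conj_of_continuous (f := σ.toRingHom) hσ with h | h
    · have h1 : ∀ w, σ w = w := fun w => RingHom.congr_fun h w
      rw [h1, h1]
    · have h1 : ∀ w, σ w = (starRingEnd ℂ) w := fun w => RingHom.congr_fun h w
      rw [h1, h1, Complex.conj_conj]
  exact hσ.congr fun z => (key z).symm

variable (σ Y) in
/-- **`Y(ℂ) ≃ₜ Y^σ(ℂ)` for a continuous automorphism `σ` of `ℂ`** (the identity or complex
conjugation): Charles–Schnell's bijection `σ : Y(ℂ) → Y^σ(ℂ)` is a homeomorphism for the strong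
topologies.  For `σ` = complex conjugation this is the anti-holomorphic identification of GAGA §2;
for a discontinuous `σ` it fails in general (Serre 1964). [cite: SerreGAGA1956, §2] -/
def conjugateHomeomorph (hσ : Continuous σ) : ComplexPoints Y ≃ₜ ComplexPoints (conjugateVariety σ Y) where
  toEquiv := conjugateEquiv σ Y
  continuous_toFun := continuous_toConjugate hσ
  continuous_invFun := continuous_ofConjugate (continuous_symm_of_continuous hσ)

/-- `conjugateHomeomorph` is `toConjugate`. [cite: SerreGAGA1956, §2] -/
@[simp] theorem conjugateHomeomorph_apply (hσ : Continuous σ) (P : ComplexPoints Y) :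
    conjugateHomeomorph σ Y hσ P = toConjugate σ Y P := rfl

/-- The inverse of `conjugateHomeomorph` is `ofConjugate`. [cite: SerreGAGA1956, §2] -/
@[simp] theorem conjugateHomeomorph_symm_apply (hσ : Continuous σ) (y' : ComplexPoints (conjugateVariety σ Y)) :
    (conjugateHomeomorph σ Y hσ).symm y' = ofConjugate σ Y y' := rfl

end AlgPoints

end Literature.AlgebraicGeometry.Motives

end
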